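import Summits.ResolutionOfSingularities.ResolutionOfSingularities.Theorems.PurelyInseparableDim4LocalGameTorus
import Summits.ResolutionOfSingularities.ResolutionOfSingularities.Theorems.PurelyInseparableDim4ScopeSymmetry
import Summits.ResolutionOfSingularities.ResolutionOfSingularities.Theorems.PurelyInseparableDim4LoopCLocalEscapeUniform
import HarnessLib

/-!
# [OURS · res-dim4-pi · F4-C-loc] THE LOCAL IN-SCOPE GAME IS `S₄`-INVARIANT: `RWins q localB (s.rename e) ↔ RWins q localB s`;
  scalar invariance `RWins q localB ⟨c·F, r, exc⟩ ↔ RWins q localB ⟨F, r, exc⟩`; renaming a lifted presented state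

Cell `res-dim4-pi` (D-0157 DOOR 2, wave 2), seat `res-dim4-p-6` g5.  Symmetry layer for the «binomial class theorem»
(the (3,3) LOCAL census as ONE quantified statement): to move a certified census root to every `S₄`-position and to
the swapped ordering of its two monomials one needs exactly
* §1 **`rWins_localB_rename_iff`** — A's attractor of the LOCAL in-scope game (`LoopCLocal.RWins q localB`, B answers
  over the current point) is invariant under renaming the four base variables.  Pattern of
  `ScopeSymmetry.inScopeStateWins_rename_iff` (p-14) over `Equivariance.step_rename` /
  `isEquimultiplePoint_rename_iff` / `isPermissibleCentre_rename_iff` (p-6 g1) and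
  `ScopeSymmetry.inCoordinateScope_rename_iff`; the only new point is that the reply class `localB` is itself
  equivariant (`localB_rename`).
* §2 **`rWins_C_mul_iff`** — the unit-scalar case `ν = 1` of the torus invariance `Torus.rWins_C_mul_scale_iff`
  (p-6 g4).
* §3 **`liftState_rename_terms`** — renaming the lift of a presented `𝔽₃` state `⟨T, 0, ∅⟩` is the lift of the
  presented state with permuted exponents `t.1 ∘ e⁻¹`.

[OURS · counted 0 · elementary bookkeeping of OUR frame; AI kernel work, weaker than expert review.]  NOTHING here is
a statement about resolution of singularities; resolution in dimension `≥ 4` / characteristic `p > 0` is NOT proved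
by anything in this file.  bears_on: LADDER-RESOLUTION:D157-DOOR2 (res-dim4-pi · (3,3) LOCAL · symmetry).  Host item
(DR-157-C): `stmt-ResolutionOfSingularities-16155`, helper.
-/

set_option linter.dupNamespace false -- mandated namespace of this single-conjunct summit

noncomputable section

open MvPolynomial Finset

namespace Summit.ResolutionOfSingularities.ResolutionOfSingularities.Theorems.PIDim4

namespace LoopCLocal

open Literature.AlgebraicGeometry.Resolution
open Literature.AlgebraicGeometry.Resolution.CentreBlowup
open StepKit

section Rename

variable {K : Type} [Field K] [DecidableEq K] (e : Equiv.Perm (Fin 4))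

/-- **the LOCAL reply class is equivariant**: a reply over the current point of the centre `S` (chart `j`) renames to
a reply over the current point of `e S` (chart `e j`). OURS. [folklore] -/
theorem localB_rename (S : Finset (Fin 4)) (j : Fin 4) (b : Fin 4 → K) (h : localB S j b = true) :
    localB (S.map e.toEmbedding) (e j) (b ∘ e.symm) = true := by
  rw [localB_eq_true_iff] at h ⊢
  intro i hi
  exact h (e.symm i) fun hmem => hi (Finset.mem_map_equiv.mpr hmem)

/-- restricted edges of the local game are equivariant. OURS. [folklore] -/
theorem rSucc_localB_rename {q : ℕ} {S : Finset (Fin 4)} {t t' : State K} (h : RSucc q localB t S t') :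
    RSucc q localB (t.rename e) (S.map e.toEmbedding) (t'.rename e) := by
  obtain ⟨j, b, hj, hbj, hρ, heq, hne, rfl⟩ := h
  refine ⟨e j, b ∘ e.symm, (Finset.mem_map' e.toEmbedding).mpr hj, ?_, localB_rename e S j b hρ,
    (Equivariance.isEquimultiplePoint_rename_iff e q S j b t).mpr heq, ?_,
    (Equivariance.step_rename e q S j b t).symm⟩
  · show b (e.symm (e j)) = 0
    rw [Equiv.symm_apply_apply]; exact hbj
  · rw [Equivariance.step_rename, Equivariance.rename_F]
    exact fun h0 => hne (rename_injective (⇑e) e.injective (by rw [h0, map_zero]))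

/-- local A-wins rename to local A-wins. OURS. [folklore] -/
theorem rWins_localB_rename (q : ℕ) {s : State K} (h : RWins q localB s) : RWins q localB (s.rename e) := by
  unfold RWins at h ⊢
  induction h with
  | @terminal s hs =>
    refine Game.Wins.terminal fun S hS => hs (S.map e.symm.toEmbedding) ⟨?_, ?_⟩
    · exact (ScopeSymmetry.inCoordinateScope_rename_iff e q s.F).mp hS.1
    · rw [← Equivariance.isPermissibleCentre_rename_iff e, Equivariance.map_symm_map]
      exact hS.2
  | @move s S hS _ ih =>
    refine Game.Wins.move (m := S.map e.toEmbedding)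
      ⟨(ScopeSymmetry.inCoordinateScope_rename_iff e q s.F).mpr hS.1,
        (Equivariance.isPermissibleCentre_rename_iff e q S s.F).mpr hS.2⟩ fun t' ht' => ?_
    have hback := rSucc_localB_rename e.symm ht'
    rw [Equivariance.rename_rename_symm] at hback
    have hS' : (S.map e.toEmbedding).map e.symm.toEmbedding = S := by
      have h1 := Equivariance.map_symm_map e.symm S
      rwa [Equiv.symm_symm] at h1
    rw [hS'] at hback
    have hw := ih (t'.rename e.symm) hback
    have ht : (t'.rename e.symm).rename e = t' := by
      have h2 := Equivariance.rename_rename_symm e.symm t'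
      rwa [Equiv.symm_symm] at h2
    rwa [ht] at hw

/-- **THE LOCAL IN-SCOPE GAME IS `S₄`-INVARIANT.** OURS. [folklore] -/
theorem rWins_localB_rename_iff (q : ℕ) (s : State K) :
    RWins q localB (s.rename e) ↔ RWins q localB s := by
  refine ⟨fun h => ?_, rWins_localB_rename e q⟩
  have h' := rWins_localB_rename e.symm q h
  rwa [Equivariance.rename_rename_symm] at h'

end Rename

section Scalar

variable {K : Type} [Field K] [DecidableEq K]

/-- **unit scalars do not change the local game**: `⟨c·F, r, exc⟩` is a local A-win iff `⟨F, r, exc⟩` is (`ν = 1` in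
`Torus.rWins_C_mul_scale_iff`). OURS. [folklore] -/
theorem rWins_C_mul_iff {q : ℕ} {c : K} (hc : c ≠ 0) (F : MvPolynomial (Fin 4) K) (r : Fin 4 →₀ ℕ)
    (exc : Finset (Fin 4)) :
    RWins q localB (⟨C c * F, r, exc⟩ : State K) ↔ RWins q localB (⟨F, r, exc⟩ : State K) := by
  have h := Torus.rWins_C_mul_scale_iff (q := q) hc (ν := fun _ => (1 : K)) (fun _ => one_ne_zero) F r exc
  have hX : (fun i : Fin 4 => C ((fun _ : Fin 4 => (1 : K)) i) * X i) = X := by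
    funext i; simp
  rwa [hX, MvPolynomial.aeval_X_left, AlgHom.coe_id, id_eq] at h

end Scalar

section Lift

variable (L : Type) [Field L] [CharP L 3] (e : Equiv.Perm (Fin 4))

/-- renaming the evaluation of a term list permutes the exponent functions by `e⁻¹`. OURS. [folklore] -/
theorem rename_map_evalT (T : Terms 4 (ZMod 3)) :
    rename e (MvPolynomial.map (φ3 L) (evalT T)) =
      MvPolynomial.map (φ3 L) (evalT (T.map fun t => (t.1 ∘ ⇑e.symm, t.2))) := by
  induction T with
  | nil => simp
  | cons t T ih =>
    have hd : Finsupp.mapDomain (⇑e) (expo t.1) = expo (t.1 ∘ ⇑e.symm) := by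
      ext i
      rw [Finsupp.mapDomain_equiv_apply, expo_apply, expo_apply, Function.comp_apply]
    rw [List.map_cons, evalT_cons, evalT_cons, map_add, map_add, map_add, ih, map_monomial, map_monomial,
      rename_monomial, hd]

/-- **renaming a lifted presented state** `⟨T, 0, ∅⟩`: the lift of the presented state with exponents permuted by
`e⁻¹`. OURS. [folklore] -/
theorem liftState_rename_terms (T : Terms 4 (ZMod 3)) :
    (liftState L ((⟨T, 0, ∅⟩ : SData 4 (ZMod 3)).toState)).rename e =
      liftState L ((⟨T.map fun t => (t.1 ∘ ⇑e.symm, t.2), 0, ∅⟩ : SData 4 (ZMod 3)).toState) := by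
  show (⟨rename e (MvPolynomial.map (φ3 L) (evalT T)), (expo (0 : Fin 4 → ℕ)).mapDomain e,
      (∅ : Finset (Fin 4)).map e.toEmbedding⟩ : State L) =
    ⟨MvPolynomial.map (φ3 L) (evalT (T.map fun t => (t.1 ∘ ⇑e.symm, t.2))), expo (0 : Fin 4 → ℕ), ∅⟩
  rw [rename_map_evalT, (expo_eq_zero_iff _).mpr rfl, Finsupp.mapDomain_zero, Finset.map_empty]

end Lift

end LoopCLocal

end Summit.ResolutionOfSingularities.ResolutionOfSingularities.Theorems.PIDim4

end
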